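import Mathlib

/-!
# (N4) THE DRIFT BOUND AT A FIRST HIT and (N4b) THE PRESSURISATION OF A SLOW HIT (nsreg-p2 g36 ROUND-46 v1.1 §7, plates t49-N4 /
t49-N4b; texts `r46/Sketch46b.lean` sha16 642a48bf5342366b, Props `NsregP2.R46b.FirstHitDriftBound` and
`NsregP2.R46b.PressurisationOfSlowHit`; seeds R47-1)

Width pieces for crux `EulerZoomLiouville.PowerGaugeEulerLiouville` (stmt-NavierStokesRegularity-19832), by name under LEAD 19832
(ns-typeII-p2); seat ns-sfl-p1 g7, `--supports stmt-NavierStokesRegularity-19832 --as helper`.  Texts binder-for-binder (`E3`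
spelled out).

* (N4) `firstHitDriftBound`: if `⟪y, e⟫ = s`, `‖y‖ ≤ q s` (`q ≥ 1`), `⟪V, e⟫ = −γ′ s` with `γ′ ≥ γ ≥ 0` and `‖V‖ ≤ h s`, then the
  self-similar drift `W = γ y + V` satisfies `‖W‖² ≤ (h² + γ² q² − 2 γ γ′ + 2 γ h √(q² − 1)) s²` (axial/transverse split:
  `⟪y, V⟫ = ⟪y_⊥, V_⊥⟫ − γ′ s²`, `‖y_⊥‖ ≤ √(q²−1) s`, `‖V_⊥‖ ≤ ‖V‖ ≤ h s`).
* (N4b) `pressurisationOfSlowHit`: with the similarity Bernoulli function `ℋ = ½‖W‖² + P + ½ γ(γ−1) ‖y‖²`, a point with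
  `ℋ ≥ ℋ₀`, `‖W‖² ≤ ω s²`, `‖y‖ ≥ s ≥ 0`, `0 < γ < 1` has `P ≥ ℋ₀ + ½ (γ(1−γ) − ω) s²` (pure bookkeeping).

HONEST FRAMING: elementary inequalities (kinematic bookkeeping for hypothetical self-similar profiles); nothing here proves the
crux E (19832 OPEN), any door Target, or any Navier–Stokes statement. [folklore]
-/

noncomputable section

open Set Real
open scoped RealInnerProductSpace

set_option linter.dupNamespace false

namespace Summit.NavierStokesRegularity.NavierStokesRegularity.Theorems.PowerGaugeEulerLiouville.Condenser

/-- **(N4) `NsregP2.R46b.FirstHitDriftBound`, binder-for-binder.**  See the module docstring. [folklore] -/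
theorem firstHitDriftBound :
    ∀ (y V e : EuclideanSpace ℝ (Fin 3)) (s q γ γ' h : ℝ), ‖e‖ = 1 → 0 ≤ s → 1 ≤ q → 0 ≤ γ → γ ≤ γ' →
      ⟪y, e⟫ = s → ‖y‖ ≤ q * s → ⟪V, e⟫ = -(γ' * s) → ‖V‖ ≤ h * s →
        ‖γ • y + V‖ ^ 2 ≤ (h ^ 2 + γ ^ 2 * q ^ 2 - 2 * γ * γ' + 2 * γ * h * sqrt (q ^ 2 - 1)) * s ^ 2 := by
  intro y V e s q γ γ' h he hs hq hγ hγγ' hye hyn hVe hVn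
  have hee : ⟪e, e⟫ = 1 := by rw [real_inner_self_eq_norm_sq, he, one_pow]
  -- transverse parts
  set yp : EuclideanSpace ℝ (Fin 3) := y - s • e with hyp
  set Vp : EuclideanSpace ℝ (Fin 3) := V + (γ' * s) • e with hVp
  have hype : ⟪yp, e⟫ = 0 := by
    rw [hyp, inner_sub_left, real_inner_smul_left, hye, hee]; ring
  have hVpe : ⟪Vp, e⟫ = 0 := by
    rw [hVp, inner_add_left, real_inner_smul_left, hVe, hee]; ring
  -- `⟪y, V⟫ = ⟪y_⊥, V_⊥⟫ − γ′ s²`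
  have hyV : ⟪y, V⟫ = ⟪yp, Vp⟫ - γ' * s ^ 2 := by
    have ey : y = yp + s • e := by rw [hyp]; abel
    have eV : V = Vp - (γ' * s) • e := by rw [hVp]; simp
    rw [ey, eV, inner_add_left, inner_sub_right, inner_sub_right, real_inner_smul_left, real_inner_smul_right,
      real_inner_smul_left, real_inner_smul_right, hee, hype, real_inner_comm Vp e, hVpe]
    ring
  -- norms of the transverse parts
  have hyp2 : ‖yp‖ ^ 2 = ‖y‖ ^ 2 - s ^ 2 := by
    have ey : y = yp + s • e := by rw [hyp]; abel
    have h1 : ‖y‖ ^ 2 = ‖yp‖ ^ 2 + 2 * ⟪yp, s • e⟫ + ‖s • e‖ ^ 2 := by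
      rw [ey]; exact norm_add_sq_real _ _
    rw [real_inner_smul_right, hype, norm_smul, he, Real.norm_eq_abs, mul_one, sq_abs] at h1
    linarith
  have hVp2 : ‖Vp‖ ^ 2 = ‖V‖ ^ 2 - γ' ^ 2 * s ^ 2 := by
    have eV : V = Vp + (-(γ' * s)) • e := by rw [hVp, neg_smul]; simp
    have h1 : ‖V‖ ^ 2 = ‖Vp‖ ^ 2 + 2 * ⟪Vp, (-(γ' * s)) • e⟫ + ‖(-(γ' * s)) • e‖ ^ 2 := by
      rw [eV]; exact norm_add_sq_real _ _
    rw [real_inner_smul_right, hVpe, norm_smul, he, Real.norm_eq_abs, mul_one, sq_abs] at h1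
    nlinarith [h1]
  -- the bounds `‖y_⊥‖ ≤ √(q²−1) s`, `‖V_⊥‖ ≤ h s`
  have hq2 : 0 ≤ q ^ 2 - 1 := by nlinarith
  have hyn2 : ‖y‖ ^ 2 ≤ (q * s) ^ 2 := pow_le_pow_left₀ (norm_nonneg _) hyn 2
  have hypn : ‖yp‖ ≤ sqrt (q ^ 2 - 1) * s := by
    have h0 : 0 ≤ sqrt (q ^ 2 - 1) * s := mul_nonneg (Real.sqrt_nonneg _) hs
    refine (pow_le_pow_iff_left₀ (norm_nonneg _) h0 two_ne_zero).1 ?_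
    rw [mul_pow, Real.sq_sqrt hq2, hyp2]
    nlinarith
  have hVn0 : 0 ≤ h * s := (norm_nonneg V).trans hVn
  have hVpn : ‖Vp‖ ≤ h * s := by
    refine (pow_le_pow_iff_left₀ (norm_nonneg _) hVn0 two_ne_zero).1 ?_
    rw [hVp2]
    nlinarith [pow_le_pow_left₀ (norm_nonneg _) hVn 2, sq_nonneg (γ' * s)]
  have hCS : ⟪yp, Vp⟫ ≤ sqrt (q ^ 2 - 1) * s * (h * s) :=
    (real_inner_le_norm _ _).trans (mul_le_mul hypn hVpn (norm_nonneg _) (mul_nonneg (Real.sqrt_nonneg _) hs))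
  -- assemble
  have hexp : ‖γ • y + V‖ ^ 2 = γ ^ 2 * ‖y‖ ^ 2 + 2 * γ * ⟪y, V⟫ + ‖V‖ ^ 2 := by
    rw [norm_add_sq_real, norm_smul, Real.norm_eq_abs, abs_of_nonneg hγ, real_inner_smul_left]; ring
  rw [hexp, hyV]
  have hV2 : ‖V‖ ^ 2 ≤ (h * s) ^ 2 := pow_le_pow_left₀ (norm_nonneg _) hVn 2
  have h3 : 2 * γ * (⟪yp, Vp⟫ - γ' * s ^ 2) ≤ 2 * γ * (sqrt (q ^ 2 - 1) * s * (h * s) - γ' * s ^ 2) :=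
    mul_le_mul_of_nonneg_left (by linarith) (by positivity)
  have h4 : γ ^ 2 * ‖y‖ ^ 2 ≤ γ ^ 2 * (q * s) ^ 2 := mul_le_mul_of_nonneg_left hyn2 (sq_nonneg _)
  nlinarith [h3, h4, hV2]

/-- **(N4b) `NsregP2.R46b.PressurisationOfSlowHit`, binder-for-binder.**  See the module docstring. [folklore] -/
theorem pressurisationOfSlowHit :
    ∀ (P H0 normW normY s γ ω : ℝ), 0 < γ → γ < 1 → 0 ≤ s → s ≤ normY → normW ^ 2 ≤ ω * s ^ 2 →
      H0 ≤ normW ^ 2 / 2 + P + γ * (γ - 1) / 2 * normY ^ 2 →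
        H0 + (γ * (1 - γ) - ω) / 2 * s ^ 2 ≤ P := by
  intro P H0 normW normY s γ ω hγ hγ1 hs hsY hW hH
  have hY2 : s ^ 2 ≤ normY ^ 2 := pow_le_pow_left₀ hs hsY 2
  have hγγ : 0 < γ * (1 - γ) := mul_pos hγ (by linarith)
  nlinarith [mul_le_mul_of_nonneg_left hY2 hγγ.le]

end Summit.NavierStokesRegularity.NavierStokesRegularity.Theorems.PowerGaugeEulerLiouville.Condenser

end
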